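import Summits.CriticalPhenomena.CardyFormulaZ2.Theorems.CardyBoundaryCoulombGasBoundaryDefectGaussianRStubRigidityOfLocalLawsPart5
import HarnessLib

/-!
# Stub `stub_boundaryFeet` of line `excursion-kernel-covariance` — Part 1:
# the cyclic-order lemma (crux `RectilinearCardy`, stmt-CriticalPhenomena-5660)

A purely combinatorial fact about the boundary walk `dsucc V` on the exterior darts of a finite
lattice set `V`, which is the global half of the boundary-feet theorem. Suppose every exterior
dart `d` carries a real "foot" `f d ∈ [0, 1)` (a point of the circle `ℝ/ℤ`) such that, with the
increment `Δ d = fract (f (dsucc d) - f d)` (so `f (dsucc d) ≡ f d + Δ d (mod 1)`):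

* (L1) `Δ d < 1/2`;
* (L2) every exterior dart whose foot lies in the half-open arc `(f d, f d + Δ d]` of the circle is
  `dsucc d` or `dsucc (dsucc d)`;
* (L3) two consecutive increments are never both zero.

Then the `dsucc`-orbit of any exterior dart `d₀` contains ALL exterior darts, and the lifted feet
`F n = f d₀ + Σ_{i<n} Δ (dsucc^[i] d₀)` wind exactly once per period: `F (n + P) = F n + 1`
(`bft_cyclic`). (The lift crosses every level `x ∈ (F 0, F P]` inside some step
`(F i, F (i+1)]`, and (L2) identifies the dart met there.) [folklore]
-/

noncomputable section

open Literature.Probability.LatticeModels Literature.Probability.LatticeModels.CollarLegModel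
open Summit.CriticalPhenomena.CardyFormulaZ2.Cruxes.BoundaryDefectGaussianR.RainbowMonomialsInExcursionKernels

namespace Summit.CriticalPhenomena.CardyFormulaZ2.Cruxes.RectilinearCardy.ExcursionKernelCovariance

/-- The increment of the foot along one step of the boundary walk, read in `[0, 1)`:
`fract (f (dsucc d) - f d)`. [folklore] -/
def bftInc (V : Finset (ℤ × ℤ)) (f : Dart → ℝ) (d : Dart) : ℝ :=
  Int.fract (f (dsucc V d) - f d)

/-- The lifted foot after `n` steps of the boundary walk from `d₀`: `f d₀` plus the first `n`
increments. [folklore] -/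
def bftLift (V : Finset (ℤ × ℤ)) (f : Dart → ℝ) (d₀ : Dart) (n : ℕ) : ℝ :=
  f d₀ + ∑ i ∈ Finset.range n, bftInc V f ((dsucc V)^[i] d₀)

/-- The boundary successor moves every dart. [folklore] -/
theorem bft_dsucc_ne (V : Finset (ℤ × ℤ)) (d : Dart) : dsucc V d ≠ d := by
  obtain ⟨v, k⟩ := d
  have hk1 : k + 1 ≠ k := by revert k; decide
  have hk3 : k + 3 ≠ k := by revert k; decide
  have hne : ∀ k : Fin 4, dir k ≠ 0 := by decide
  by_cases hA : v + dir (k + 1) ∈ V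
  · by_cases hB : v + dir (k + 1) + dir k ∈ V
    · have e : dsucc V (v, k) = (v + dir (k + 1) + dir k, k + 3) := by simp [dsucc, hA, hB]
      rw [e]; simp [hk3]
    · have e : dsucc V (v, k) = (v + dir (k + 1), k) := by simp [dsucc, hA, hB]
      rw [e]; simp [hne]
  · have e : dsucc V (v, k) = (v, k + 1) := by simp [dsucc, hA]
    rw [e]; simp [hk1]

/-- One step of the lift. [folklore] -/
theorem bft_lift_succ (V : Finset (ℤ × ℤ)) (f : Dart → ℝ) (d₀ : Dart) (n : ℕ) :
    bftLift V f d₀ (n + 1) = bftLift V f d₀ n + bftInc V f ((dsucc V)^[n] d₀) := by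
  simp [bftLift, Finset.sum_range_succ, add_assoc]

/-- The lift starts at the foot of `d₀`. [folklore] -/
theorem bft_lift_zero (V : Finset (ℤ × ℤ)) (f : Dart → ℝ) (d₀ : Dart) :
    bftLift V f d₀ 0 = f d₀ := by
  simp [bftLift]

/-- The lift is non-decreasing. [folklore] -/
theorem bft_lift_mono (V : Finset (ℤ × ℤ)) (f : Dart → ℝ) (d₀ : Dart) {n m : ℕ} (h : n ≤ m) :
    bftLift V f d₀ n ≤ bftLift V f d₀ m := by
  induction h with
  | refl => exact le_rfl
  | step _ ih =>
    refine ih.trans ?_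
    rw [bft_lift_succ]
    exact le_add_of_nonneg_right (Int.fract_nonneg _)

/-- The lift projects to the foot of the current dart: `F n ≡ f (dsucc^[n] d₀) (mod 1)`.
[folklore] -/
theorem bft_lift_mod (V : Finset (ℤ × ℤ)) (f : Dart → ℝ) (d₀ : Dart) (n : ℕ) :
    ∃ k : ℤ, bftLift V f d₀ n = f ((dsucc V)^[n] d₀) + k := by
  induction n with
  | zero => exact ⟨0, by simp [bftLift]⟩
  | succ n ih =>
    obtain ⟨k, hk⟩ := ih
    refine ⟨k - ⌊f ((dsucc V)^[n + 1] d₀) - f ((dsucc V)^[n] d₀)⌋, ?_⟩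
    rw [bft_lift_succ, hk, bftInc, ← Function.iterate_succ_apply' (dsucc V) n d₀, Int.fract]
    push_cast
    ring

/-- **Crossing a level.** Every level `x ∈ (F 0, F P]` is crossed inside some step:
`F i < x ≤ F (i+1)` with `i < P`. [folklore] -/
theorem bft_lift_cross (V : Finset (ℤ × ℤ)) (f : Dart → ℝ) (d₀ : Dart) {P : ℕ} {x : ℝ}
    (h0 : bftLift V f d₀ 0 < x) (hP : x ≤ bftLift V f d₀ P) :
    ∃ i, i < P ∧ bftLift V f d₀ i < x ∧ x ≤ bftLift V f d₀ (i + 1) := by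
  classical
  have hP0 : 0 < P := by
    rcases Nat.eq_zero_or_pos P with rfl | h
    · exact absurd hP (not_le.2 h0)
    · exact h
  set T := (Finset.range P).filter (fun i => bftLift V f d₀ i < x) with hT
  have h0T : 0 ∈ T := Finset.mem_filter.2 ⟨Finset.mem_range.2 hP0, h0⟩
  have hTne : T.Nonempty := ⟨0, h0T⟩
  obtain ⟨hiP, hix⟩ := Finset.mem_filter.1 (Finset.max'_mem T hTne)
  have hiP' := Finset.mem_range.1 hiP
  refine ⟨T.max' hTne, hiP', hix, ?_⟩
  by_contra hlt
  rw [not_le] at hlt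
  rcases Nat.lt_or_ge (T.max' hTne + 1) P with h | h
  · have hmem : T.max' hTne + 1 ∈ T := Finset.mem_filter.2 ⟨Finset.mem_range.2 h, hlt⟩
    have := Finset.le_max' T _ hmem
    omega
  · have hP' : P = T.max' hTne + 1 := by omega
    rw [hP'] at hP
    linarith

/-- **The cyclic-order lemma, given the period.** See `bft_cyclic`. [folklore] -/
theorem bft_cyclic_aux (V : Finset (ℤ × ℤ)) (f : Dart → ℝ)
    (hf : ∀ d : Dart, d.1 ∈ V → dartTip d ∉ V → 0 ≤ f d ∧ f d < 1)
    (hL1 : ∀ d : Dart, d.1 ∈ V → dartTip d ∉ V → bftInc V f d < 1 / 2)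
    (hL2 : ∀ d d'' : Dart, d.1 ∈ V → dartTip d ∉ V → d''.1 ∈ V → dartTip d'' ∉ V → ∀ j : ℤ,
      f d < f d'' + j → f d'' + j ≤ f d + bftInc V f d →
      d'' = dsucc V d ∨ d'' = dsucc V (dsucc V d))
    (hL3 : ∀ d : Dart, d.1 ∈ V → dartTip d ∉ V → bftInc V f d = 0 → bftInc V f (dsucc V d) ≠ 0)
    (d₀ : Dart) (h₀ : d₀.1 ∈ V) (h₀' : dartTip d₀ ∉ V) {P : ℕ} (hP0 : 0 < P)
    (hret : (dsucc V)^[P] d₀ = d₀) (hmin : ∀ m, 0 < m → m < P → (dsucc V)^[m] d₀ ≠ d₀) :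
    (∀ d : Dart, d.1 ∈ V → dartTip d ∉ V → ∃ n, n ≤ P + 1 ∧ (dsucc V)^[n] d₀ = d) ∧
    (∀ n, bftLift V f d₀ (n + P) = bftLift V f d₀ n + 1) := by
  have hext : ∀ n, ((dsucc V)^[n] d₀).1 ∈ V ∧ dartTip ((dsucc V)^[n] d₀) ∉ V :=
    fun n => (s3_dsucc_iterate V n).1 d₀ h₀ h₀'
  have hstep := bft_lift_succ V f d₀
  have hmod := bft_lift_mod V f d₀
  have hF0 := bft_lift_zero V f d₀
  have hinc0 : ∀ n, 0 ≤ bftInc V f ((dsucc V)^[n] d₀) := fun n => Int.fract_nonneg _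
  have hinc2 : ∀ n, bftInc V f ((dsucc V)^[n] d₀) < 1 / 2 :=
    fun n => hL1 _ (hext n).1 (hext n).2
  -- the winding number
  obtain ⟨W, hW⟩ : ∃ W : ℤ, bftLift V f d₀ P = f d₀ + W := by
    obtain ⟨k, hk⟩ := hmod P
    exact ⟨k, by rw [hk, hret]⟩
  -- crossing a level identifies the dart
  have hcross : ∀ d'' : Dart, d''.1 ∈ V → dartTip d'' ∉ V → ∀ j : ℤ,
      bftLift V f d₀ 0 < f d'' + j → f d'' + j ≤ bftLift V f d₀ P →
      ∃ i, i < P ∧ bftLift V f d₀ i < f d'' + j ∧ f d'' + j ≤ bftLift V f d₀ (i + 1) ∧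
        (d'' = (dsucc V)^[i + 1] d₀ ∨ d'' = (dsucc V)^[i + 2] d₀) := by
    intro d'' hd'' hd''t j h1 h2
    obtain ⟨i, hiP, hi1, hi2⟩ := bft_lift_cross V f d₀ h1 h2
    refine ⟨i, hiP, hi1, hi2, ?_⟩
    obtain ⟨k, hk⟩ := hmod i
    have hi2' := hi2
    rw [hstep i, hk] at hi2'
    rw [hk] at hi1
    have h := hL2 ((dsucc V)^[i] d₀) d'' (hext i).1 (hext i).2 hd'' hd''t (j - k)
      (by push_cast; linarith) (by push_cast; linarith)
    rcases h with h | h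
    · left
      rw [h, ← Function.iterate_succ_apply' (dsucc V) i d₀]
    · right
      rw [h, ← Function.iterate_succ_apply' (dsucc V) i d₀,
        ← Function.iterate_succ_apply' (dsucc V) (i + 1) d₀]
  -- W ≥ 1
  have hW1 : 1 ≤ W := by
    by_contra hlt
    have hW0 : (W : ℝ) ≤ 0 := by exact_mod_cast (show W ≤ 0 by omega)
    have hsum0 : ∑ i ∈ Finset.range P, bftInc V f ((dsucc V)^[i] d₀) = 0 := by
      have e : bftLift V f d₀ P = f d₀ + ∑ i ∈ Finset.range P, bftInc V f ((dsucc V)^[i] d₀) :=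
        rfl
      have hnn : 0 ≤ ∑ i ∈ Finset.range P, bftInc V f ((dsucc V)^[i] d₀) :=
        Finset.sum_nonneg fun i _ => hinc0 i
      linarith
    have hzero : ∀ i, i < P → bftInc V f ((dsucc V)^[i] d₀) = 0 := fun i hi =>
      (Finset.sum_eq_zero_iff_of_nonneg fun i _ => hinc0 i).1 hsum0 i (Finset.mem_range.2 hi)
    have hP2 : 2 ≤ P := by
      by_contra h
      have hP1 : P = 1 := by omega
      have := hret
      rw [hP1, Function.iterate_one] at this
      exact bft_dsucc_ne V d₀ this
    have h0 := hzero 0 hP0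
    have h1 := hzero 1 (by omega)
    simp only [Function.iterate_zero, id_eq, Function.iterate_one] at h0 h1
    exact hL3 d₀ h₀ h₀' h0 h1
  -- W ≤ 1
  have hW2 : W ≤ 1 := by
    by_contra hlt
    have hW2' : (2 : ℝ) ≤ W := by exact_mod_cast (show 2 ≤ W by omega)
    have hx1 : bftLift V f d₀ 0 < f d₀ + (1 : ℤ) := by rw [hF0]; push_cast; linarith
    have hx2 : f d₀ + (1 : ℤ) ≤ bftLift V f d₀ P := by rw [hW]; push_cast; linarith
    obtain ⟨i, hiP, hi1, -, hd⟩ := hcross d₀ h₀ h₀' 1 hx1 hx2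
    push_cast at hi1
    rcases hd with hd | hd
    · -- `dsucc^[i+1] d₀ = d₀` forces `i + 1 = P`
      have hi : i + 1 = P := by
        by_contra hne
        exact hmin (i + 1) (Nat.succ_pos i) (by omega) hd.symm
      have e1 : bftLift V f d₀ P = bftLift V f d₀ i + bftInc V f ((dsucc V)^[i] d₀) := by
        rw [← hi]; exact hstep i
      linarith [hinc2 i]
    · rcases Nat.lt_or_ge (i + 2) P with h | h
      · exact hmin (i + 2) (by omega) h hd.symm
      · rcases Nat.eq_or_lt_of_le h with h' | h'
        · have e1 : bftLift V f d₀ P = bftLift V f d₀ i + bftInc V f ((dsucc V)^[i] d₀) +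
              bftInc V f ((dsucc V)^[i + 1] d₀) := by
            rw [h', ← hstep i, ← hstep (i + 1)]
          linarith [hinc2 i, hinc2 (i + 1)]
        · have hi : i + 1 = P := by omega
          have e1 : bftLift V f d₀ P = bftLift V f d₀ i + bftInc V f ((dsucc V)^[i] d₀) := by
            rw [← hi]; exact hstep i
          linarith [hinc2 i, hinc0 i]
  have hWeq : W = 1 := le_antisymm hW2 hW1
  rw [hWeq] at hW
  push_cast at hW
  refine ⟨fun d hd hdt => ?_, fun n => ?_⟩
  · -- surjectivity
    have hfd := hf d hd hdt
    have hf0 := hf d₀ h₀ h₀'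
    obtain ⟨j, hj1, hj2⟩ : ∃ j : ℤ, bftLift V f d₀ 0 < f d + j ∧ f d + j ≤ bftLift V f d₀ P := by
      by_cases hlt : f d₀ < f d
      · exact ⟨0, by rw [hF0]; push_cast; linarith, by rw [hW]; push_cast; linarith⟩
      · rw [not_lt] at hlt
        exact ⟨1, by rw [hF0]; push_cast; linarith, by rw [hW]; push_cast; linarith⟩
    obtain ⟨i, hiP, -, -, hd'⟩ := hcross d hd hdt j hj1 hj2
    rcases hd' with h | h
    · exact ⟨i + 1, by omega, h.symm⟩
    · exact ⟨i + 2, by omega, h.symm⟩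
  · -- periodicity of the lift
    induction n with
    | zero => rw [Nat.zero_add, hW, hF0]
    | succ n ih =>
      rw [show n + 1 + P = (n + P) + 1 by omega, hstep (n + P), hstep n, ih,
        Function.iterate_add_apply, hret]
      ring

/-- **The cyclic-order lemma** (global half of the boundary-feet theorem). See the module
docstring: under (L1)–(L3) the orbit of an exterior dart `d₀` under the boundary walk is all of
the exterior darts, it is a cycle of length `period V d₀`, and the lifted feet increase by exactly
`1` per period and project to the feet of the darts. [folklore] -/
theorem bft_cyclic (V : Finset (ℤ × ℤ)) (f : Dart → ℝ)
    (hf : ∀ d : Dart, d.1 ∈ V → dartTip d ∉ V → 0 ≤ f d ∧ f d < 1)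
    (hL1 : ∀ d : Dart, d.1 ∈ V → dartTip d ∉ V → bftInc V f d < 1 / 2)
    (hL2 : ∀ d d'' : Dart, d.1 ∈ V → dartTip d ∉ V → d''.1 ∈ V → dartTip d'' ∉ V → ∀ j : ℤ,
      f d < f d'' + j → f d'' + j ≤ f d + bftInc V f d →
      d'' = dsucc V d ∨ d'' = dsucc V (dsucc V d))
    (hL3 : ∀ d : Dart, d.1 ∈ V → dartTip d ∉ V → bftInc V f d = 0 → bftInc V f (dsucc V d) ≠ 0)
    (d₀ : Dart) (h₀ : d₀.1 ∈ V) (h₀' : dartTip d₀ ∉ V) :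
    0 < period V d₀ ∧
    (∀ n, (dsucc V)^[n + period V d₀] d₀ = (dsucc V)^[n] d₀) ∧
    (∀ n m, n < period V d₀ → m < period V d₀ → (dsucc V)^[n] d₀ = (dsucc V)^[m] d₀ → n = m) ∧
    (∀ d : Dart, d.1 ∈ V → dartTip d ∉ V → ∃ n, n < period V d₀ ∧ (dsucc V)^[n] d₀ = d) ∧
    (∀ n, bftLift V f d₀ (n + period V d₀) = bftLift V f d₀ n + 1) ∧
    (∀ n, ∃ k : ℤ, bftLift V f d₀ n = f ((dsucc V)^[n] d₀) + k) ∧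
    (∀ n, bftLift V f d₀ n ≤ bftLift V f d₀ (n + 1)) ∧
    (∀ n, bftLift V f d₀ (n + 1) = bftLift V f d₀ n + bftInc V f ((dsucc V)^[n] d₀)) := by
  obtain ⟨hP0, -, hret, hmin⟩ := s3_period_spec V d₀ h₀ h₀'
  have hext : ∀ n, ((dsucc V)^[n] d₀).1 ∈ V ∧ dartTip ((dsucc V)^[n] d₀) ∉ V :=
    fun n => (s3_dsucc_iterate V n).1 d₀ h₀ h₀'
  obtain ⟨hsurj, hliftP⟩ := bft_cyclic_aux V f hf hL1 hL2 hL3 d₀ h₀ h₀' hP0 hret hmin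
  have hred : ∀ m, (dsucc V)^[m] d₀ = (dsucc V)^[m % period V d₀] d₀ :=
    (s3_cycle_orbit V d₀ h₀ h₀').2.1
  refine ⟨hP0, fun n => ?_, fun n m hn hm hnm => ?_, fun d hd hdt => ?_, hliftP, bft_lift_mod V f d₀,
    fun n => bft_lift_mono V f d₀ (Nat.le_succ n), bft_lift_succ V f d₀⟩
  · rw [Function.iterate_add_apply, hret]
  · by_contra hne
    rcases lt_or_gt_of_ne hne with h | h
    · refine hmin (m - n) (Nat.sub_pos_of_lt h) (by omega) ?_
      apply (s3_dsucc_iterate V n).2 _ _ (hext _).1 (hext _).2 h₀ h₀'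
      rw [← Function.iterate_add_apply, Nat.add_sub_cancel' h.le]
      exact hnm.symm
    · refine hmin (n - m) (Nat.sub_pos_of_lt h) (by omega) ?_
      apply (s3_dsucc_iterate V m).2 _ _ (hext _).1 (hext _).2 h₀ h₀'
      rw [← Function.iterate_add_apply, Nat.add_sub_cancel' h.le]
      exact hnm
  · obtain ⟨n, -, hn⟩ := hsurj d hd hdt
    exact ⟨n % period V d₀, Nat.mod_lt _ hP0, by rw [← hred, hn]⟩

end Summit.CriticalPhenomena.CardyFormulaZ2.Cruxes.RectilinearCardy.ExcursionKernelCovariance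

end
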